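import Literature.MathematicalPhysics.QuantumFieldTheory.Balaban1983to89.B3Op116MixedSeedRegion
import Literature.MathematicalPhysics.QuantumFieldTheory.Balaban1983to89.B3Op116DKernelRegularRegion
import Literature.MathematicalPhysics.QuantumFieldTheory.Balaban1983to89.B3Op116MixedKernelRegularTorus

/-!
# Bałaban, *(Higgs)₂,₃ quantum fields in a finite volume III. Renormalization* [B3] — the kernel of the operator (1.16) p. 414 ON A
REGION `Ω`: THE MIXED (dipole-source) ENTRY `D_x(1.16)^Ω_{n,n′}D^*_{x′}` IS UNIFORMLY BOUNDED AND EXPONENTIALLY DECAYING AT INTERIOR POINTS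
FOR ALL `n + n′ > d` — the `hM` binder of p40's general-region (2.5) assembly `B3Ineq25Op116Smooth.ineq25At_op116_smooth_of_bounds`
(file R4b of the region programme of B3-CLOSURE §5 item 20; the region twin of p40 g74's `B3Op116MixedKernelRegularTorus`)

statement-level skeleton of published theorems with citation tags; proofs where landed; nothing here is a claim about the Yang–Mills mass gap

T. Bałaban, Commun. Math. Phys. **88** (1983) 411–445 [cite: Balaban1983Higgs3]; part I, Commun. Math. Phys. **85** (1982) 603–636
[cite: Balaban1982Higgs1]; [B4] Commun. Math. Phys. **89** (1983) 571–597 [cite: Balaban1983RegularityDecay].  PDFs held: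
`paper:balaban1983-higgs-2-3-quantum-fields-finite-volume` (journal page = PDF page + 410; p. 412 = `p0002.txt`, p. 414 = `p0004.txt`,
p. 426 = `p0016.txt`), `paper:balaban1982-cmp85-higgs23-i` (p. 619 = `p0017.txt`), `paper:balaban1983-cmp89-regularity-decay` (p. 573 = `p0003.txt`).

CITATION HEADER (lean-in-tree rule).  Cell `lit-balaban` (HOME `run/shared/lean/pub/lit-balaban/`), Phase-2 proof seat **p40** gen 75
(unit `lit-balaban-p40`); TAKING line HOME/STATUS 2026-08-23T09:21Z (B3-CLOSURE.md §5 item 20: the REGION twin of the (1.16) branch of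
(2.5); owner r15's welcome 09:22Z).  SKELETON rows **B3.Eq1.16** / **B3.Eq2.5** (fold owner r15; decl of record
`B3Sect2StatementsPart2.ScaledKernels.Ineq25At`, the `hM`/`hM′` slots of `B3Ineq25Op116Smooth.ineq25At_op116_smooth_of_bounds`) — a located
member (no head claim).  USED BY NAME, never restated: file R4a `B3Op116MixedSeedRegion.mixed_seed_state_region` (the seed `Wdip^B_{b′}Y` at
an interior bond in the region state `0`), file R2 `B3Op116DKernelRegularRegion.{step_state_region, state_op116_one_right_region,
state_op116_succ_right_region, state_op116_add_left_region}` (the region induction over the factors of (1.16) from an arbitrary seed triple),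
the torus file `B3Op116MixedKernelRegularTorus` for the CONSTANTS ONLY (`dipRate`, `cvW`, `cdW`, `cvDip`, `cdDip`, `mixC` and their signs
`cvW_nonneg`, `cdW_nonneg`, `cvDip_cdDip_nonneg`, `seedRate_pos_le`, `mixRate_eq`, `mixRate_pos_le`, `mixC_nonneg` — the region constants
ARE the torus constants), p35's `B3Op116DKernelRegularTorus.{seqC, rateAt, cvAt, cdAt, seqC_zero, seqC_succ, seqC_pos, mesh_rpow_split,
rate_div_eq}` and `B3Op116MajorantStep.{maj, maj_rate_mono, maj_const_mono, maj_add, maj_exponent_reduce}`, p33's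
`B3Op116MajorantConvolution.majorant_le_top`, p40 g70's `B3Eq116TwoSidedExpansion.{op116, opV, eq344_model, eq344_model_right}` (every `Ω`),
r14's `B3Op116SourceForm.{srcV, opV_apply_eq_srcV, covDerivAt, op116_succ_left_apply, op116_zero_zero_apply}`, file R1's `DeepBlk`, r14's
`Interior`/`regRegionKernels`, p33's `mixedTermR` shape, p40's `B3Ineq210MixedRegularTorus.{dip, onb, norm_onb}`, r15's `ScaledKernels.Ineq210`.

## What is printed

[B3] p. 414 [PDF 4] (verbatim): *"in the last term of this expansion, equal to [G_k(Ω,B̃)V_k(Ã,B̃)]^n G_k(Ω,Ã+B̃)[V_k(Ã,B̃)G_k(Ω,B̃)]^{n′},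
(1.16) we have the propagator G_k(Ω,Ã+B̃). … for n, n′ sufficiently large, a kernel of the operator (1.16) is a sufficiently regular
function of both variables. More exactly the Hölder norms of the covariant derivatives of this kernel … are exponentially decaying with
the distance of the arguments and are uniformly bounded by O(1)(e(L^kε)^{1−α})^{n+n′} … This estimate follows easily from the properties of
the propagators G_k(Ω, A) proved in the next paper."*  p. 412 [PDF 2] (verbatim): *"we will assume that |A|, |∂A|, |∂B| … ≤ O(1)p(L^kε)
and dist(supp A, ∂Ω) > 2r(L^kε)"*.  [B4] Theorem p. 573 [PDF 3]: (1.9)/(1.10) for `G_k(Ω,A)` at points with `dist({x,x′},Ωᶜ) ≥ R₀`.  [B1]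
p. 619 (3.44); [B3] p. 426 (2.10).

## What this file proves, and how

The torus file line by line with every state read at INTERIOR points and the dipole bond `b′` INTERIOR: §1 the second seed identity on
`Ω` (`GB_srcV_GB_eq_region`: `G_k(Ω,B̃)V_kG_k(Ω,B̃) = W − G_k(Ω,B̃)V_kW`, (I.3.44) from the left); §2 the seed `Wdip^B_{b′}e_i` in the region
state `0` of `(δ₁/(4L), cvW, cdW)` (file R4a), `G_k(Ω,B̃)V_k(Wdip)` one region step later (file R2) and brought back to exponents `(2,1)`,
hence BOTH inner seeds `G_k(Ω,X)V_kG_k(Ω,B̃)dip^B_{b′}e_i`, `X ∈ {B̃, Ã+B̃}`, in the region state `0` of the weakened triple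
`(dipRate, cvDip, cdDip)` (`seed_state_region`); §3 the region state `n + n″` of `(1.16)^Ω_{n,n″+1}dip` (`dip_state_region`) and the region
state `m` of `(1.16)^Ω_{m+1,0}dip` (`dip_state_zero_right_region`); §4 **`kernel116_mixed_le_region`**: for `d < n + n′` and INTERIOR `x, x′`,
`ε^{−d}·ε^{−1}·Σ_i‖(D^ε_B(1.16)^Ω_{n,n′}dip^B_{⟨x′,ν⟩}e_i)(⟨x,μ⟩)‖ ≤ mixC(n+n′)·(L^kε)^{n+n′}·((L^kε)^d)^{−1}·exp(−δ^mix_{n+n′−1}|x−x′|/L^k)` —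
the `hM` binder of `ineq25At_op116_smooth_of_bounds` with the torus constant `mixC` and rate `δ^mix_J = δ₁/(4L)^{J+2}`.

## Honest scope

Regions `Ω ⊆ T_ε` with the (2.10) bounds of `G_k(Ω,B̃)`, `G_k(Ω,Ã+B̃)` at `Interior k K₀ Ω` pairs in r15's shape `Ineq210 δ₁ C` on r14's
carrier (same `K₀`) and the twice-differentiated per-piece bounds in p33's `mixedTermR` shape at interior pairs with constant `C_M` —
HYPOTHESES (discharged for big-block unions and small regular backgrounds by r14's `ineq210_regularRegion_small` and p33's
`ineq210_mixed_regularRegion`, not re-proved here); `|A_b| ≤ s`, `A` (I.2.23)-regular with `δ_A` and SUPPORTED ON DEEP BONDS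
(`A_b ≠ 0 ⇒ DeepBlk b₋ ∧ DeepBlk b₊` — print's «dist(supp Ã, ∂Ω) > 2r(L^kε)», p. 412), `(L^kε)|e|s ≤ 1`, `0 < δ₁ ≤ 1`, `m² > 0`, `a > 0`,
`1 ≤ k ≤ K`; every `(n, n′)` with `n + n′ > d`; every `d ≥ 1`, `L ≥ 2`, `N`.  Conclusions at interior `x, x′` only (nothing in the
`R₀`-collar, exactly as in [B4]).  Constants = the torus constants (explicit, not optimized).  No `def` at all; no `def … : Prop`, no new named
fact; no `sorry`; axioms standard.  Value = the located dipole–dipole entry of a by-reference estimate of B3 at print's generality (regions),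
NOT summit progress.
-/

noncomputable section

open scoped BigOperators

namespace Literature.MathematicalPhysics.QuantumFieldTheory.Balaban1983to89.B3Op116MixedKernelRegularRegion

open HiggsLattice (ChargeData ScalarField covDeriv)
open HiggsCovariance (propagatorK E)
open B1Eq230FluctCov (Ix cb)
open B1Ineq234Concrete (nCol)
open B3Ineq210RegularRegion (regRegionKernels Interior)
open B3Ineq210MixedRegularRegion (mixedTermR)
open B3Op116SourceForm (srcV opV_apply_eq_srcV covDerivAt covDerivAt_apply)
open B3Op116MajorantStep (maj maj_nonneg maj_rate_mono maj_const_mono maj_add maj_exponent_reduce)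
open B3Op116MajorantConvolution (majorant_le_top)
open B3Op116DKernelRegularTorus (seqC rateAt cvAt cdAt seqC_zero seqC_succ seqC_pos rateAt_closed rateAt_pos_le mesh_rpow_split
  rate_div_eq cK1 kap4)
open B3Op116DKernelRegularRegion (step_state_region state_op116_one_right_region state_op116_succ_right_region
  state_op116_add_left_region)
open B3Op116MixedSeed (seedK1 seedK2 kC gE)
open B3Op116MixedSeedRegion (mixed_seed_state_region)
open B3Op116MixedKernelRegularTorus (dipRate cvW cdW cvDip cdDip mixC cvW_nonneg cdW_nonneg seedRate_pos_le cvDip_cdDip_nonneg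
  mixRate_eq mixRate_pos_le mixC_nonneg)
open B3Op116RegionSources (DeepBlk)
open B3Eq116TwoSidedExpansion (op116 opV eq344_model eq344_model_right)
open B3Ineq210MixedRegularTorus (dip onb norm_onb)

variable {P : HiggsLattice.Params} {N : ℕ}

/-! ## §1 The second seed identity on a region -/

section Seeds

variable {C : ChargeData N} {A B : HiggsLattice.VecField P 0} {msq a : ℝ} {k K₀ : ℕ} {hL1 : 1 < P.L} {δ₁ Cst CM s δA : ℝ}
  {Ω : Finset (HiggsLattice.Site P 0)}

/-- **(I.3.44) read from the left gives the second seed algebraically, on every region: `G_k(Ω,B̃)V_kG_k(Ω,B̃) = W − G_k(Ω,B̃)V_kW`**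
(`W = G_k(Ω,B̃)V_kG_k(Ω,Ã+B̃)`, p40 g70's `eq344_model`; `V_k` linear). [cite: Balaban1982Higgs1, (3.44) p.619] [cite: Balaban1983Higgs3, (1.16) p.414] -/
theorem GB_srcV_GB_eq_region (hL : 1 < P.L) (hmsq : 0 < msq) (ha : 0 < a) (hk : 1 ≤ k) (ψ : ScalarField P 0 N) :
    propagatorK C Ω B msq a k (srcV C A B k Ω a (propagatorK C Ω B msq a k ψ))
      = (propagatorK C Ω (A + B) msq a k - propagatorK C Ω B msq a k) ψ
        - propagatorK C Ω B msq a k (srcV C A B k Ω a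
            ((propagatorK C Ω (A + B) msq a k - propagatorK C Ω B msq a k) ψ)) := by
  have hL1' : (1 : ℝ) < (P.L : ℝ) := by exact_mod_cast hL
  have hak : 0 ≤ B1.aSeq a P.L k := (B1.aSeq_pos ha hL1' hk).le
  have h := congrArg (fun T : Module.End ℝ (ScalarField P 0 N) => T ψ) (eq344_model C Ω A B a k hmsq hak)
  simp only [LinearMap.add_apply, Module.End.mul_apply] at h
  have key : propagatorK C Ω B msq a k (opV C Ω A B msq a k (propagatorK C Ω (A + B) msq a k ψ))
      = propagatorK C Ω (A + B) msq a k ψ - propagatorK C Ω B msq a k ψ := by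
    rw [eq_sub_iff_add_eq']; exact h.symm
  rw [← opV_apply_eq_srcV C A B msq, ← opV_apply_eq_srcV C A B msq, LinearMap.sub_apply, map_sub, map_sub, key]
  abel

variable (hδ₁ : 0 < δ₁) (hδ₁1 : δ₁ ≤ 1) (hCst : 0 ≤ Cst) (hCM : 0 ≤ CM)
  (h210B : (regRegionKernels hL1 C Ω B msq a k K₀).Ineq210 δ₁ Cst)
  (hmixB : ∀ (j : ℕ) (μ ν : Fin P.d) (x x' : HiggsLattice.Site P 0), Interior k K₀ Ω x → Interior k K₀ Ω x' →
    mixedTermR C Ω B msq a k j μ ν x x' ≤ CM * (P.mesh j ^ P.d)⁻¹ * Real.exp (-(δ₁ * ((HiggsLattice.Site.tdist x x' : ℝ) / (P.L : ℝ) ^ j))))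
  (h210AB : (regRegionKernels hL1 C Ω (A + B) msq a k K₀).Ineq210 δ₁ Cst)
  (hmixAB : ∀ (j : ℕ) (μ ν : Fin P.d) (x x' : HiggsLattice.Site P 0), Interior k K₀ Ω x → Interior k K₀ Ω x' →
    mixedTermR C Ω (A + B) msq a k j μ ν x x' ≤ CM * (P.mesh j ^ P.d)⁻¹ * Real.exp (-(δ₁ * ((HiggsLattice.Site.tdist x x' : ℝ) / (P.L : ℝ) ^ j))))
  (hmsq : 0 < msq) (ha : 0 < a) (hk : 1 ≤ k) (hkK : k ≤ P.K) (i₀ : Ix N)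
  (hs : 0 ≤ s) (hA : ∀ b : HiggsLattice.PBond P 0, |A b| ≤ s) (hδA : 0 ≤ δA)
  (hregA : ∀ (z : HiggsLattice.Site P 0) (μ ν : Fin P.d), |A ⟨z.shift ν, μ⟩ - A ⟨z, μ⟩| ≤ δA)
  (hAS : ∀ b : HiggsLattice.PBond P 0, A b ≠ 0 → DeepBlk k K₀ Ω b.src ∧ DeepBlk k K₀ Ω b.tgt)
  (ht1 : P.mesh k * (|C.e| * s) ≤ 1)
include hδ₁ hδ₁1 hCst hCM h210B hmixB h210AB hmixAB hmsq ha hk hkK i₀ hs hA hδA hregA hAS ht1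

/-! ## §2 The two inner seeds `G_k(Ω,X)V_kG_k(Ω,B̃)dip^B_{b′}e_i`, `X ∈ {B̃, Ã+B̃}`, at an interior dipole bond, in the region state `0` of the
weakened triple -/

/-- **The mixed seed on a region for a unit charge**: for an interior dipole bond `b′`, `Wdip^B_{b′}e_i` is in the region state `0` of
`(δ₁/(4L), cvW, cdW)` (file R4a's `mixed_seed_state_region`, `‖e_i‖ = 1`). [cite: Balaban1983Higgs3, (1.16) p.414, (2.10) p.426, p.412] [cite: Balaban1982Higgs1, (3.44) p.619] -/
theorem W_dip_state_region {b' : HiggsLattice.PBond P 0} (hb' : Interior k K₀ Ω b'.src) (i : Ix N) :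
    (∀ y, Interior k K₀ Ω y →
      ‖(propagatorK C Ω (A + B) msq a k - propagatorK C Ω B msq a k) (dip C B b' (onb N i)) y‖
        ≤ maj P k (cvW P N C k a δ₁ Cst CM s δA) 2 (δ₁ / 2 / 2 / P.L) y b'.src) ∧
    (∀ b₀ : HiggsLattice.PBond P 0, Interior k K₀ Ω b₀.src →
      ‖covDeriv C B ((propagatorK C Ω (A + B) msq a k - propagatorK C Ω B msq a k) (dip C B b' (onb N i))) b₀‖
        ≤ maj P k (cdW P N C k a δ₁ Cst CM s δA) 1 (δ₁ / 2 / 2 / P.L) b₀.src b'.src) := by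
  have h := mixed_seed_state_region hmsq ha hk hkK hδ₁ hδ₁1 hCst hCM hs hδA ht1 h210B hmixB h210AB hmixAB hA hregA hAS i₀ hb' (onb N i)
  rw [norm_onb] at h
  exact h

/-- **`G_k(Ω,B̃)V_k(Wdip^B_{b′}e_i)` is in the region state `1` of `(δ₁/(4L), cvW, cdW)`, read at exponents `(2, 1)`** (file R2's
`step_state_region` + `maj_exponent_reduce`). [cite: Balaban1983Higgs3, (1.16) p.414, (2.10) p.426, p.412] -/
theorem GB_srcV_W_dip_bound_region {b' : HiggsLattice.PBond P 0} (hb' : Interior k K₀ Ω b'.src) (i : Ix N) :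
    (∀ y, Interior k K₀ Ω y → ‖propagatorK C Ω B msq a k (srcV C A B k Ω a
          ((propagatorK C Ω (A + B) msq a k - propagatorK C Ω B msq a k) (dip C B b' (onb N i)))) y‖
        ≤ maj P k (cvAt P N C k a Cst s δA (δ₁ / 2 / 2 / P.L) (cvW P N C k a δ₁ Cst CM s δA) (cdW P N C k a δ₁ Cst CM s δA) 1
            * P.mesh k) 2 (dipRate P δ₁) y b'.src) ∧
    (∀ b₀ : HiggsLattice.PBond P 0, Interior k K₀ Ω b₀.src → ‖covDeriv C B (propagatorK C Ω B msq a k (srcV C A B k Ω a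
          ((propagatorK C Ω (A + B) msq a k - propagatorK C Ω B msq a k) (dip C B b' (onb N i))))) b₀‖
        ≤ maj P k (cdAt P N C k a Cst s δA (δ₁ / 2 / 2 / P.L) (cvW P N C k a δ₁ Cst CM s δA) (cdW P N C k a δ₁ Cst CM s δA) 1
            * P.mesh k) 1 (dipRate P δ₁) b₀.src b'.src) := by
  have hL : 1 < P.L := hL1
  have hv := cvW_nonneg (P := P) (N := N) (C := C) (k := k) hL hδ₁ hCst hCM ha.le hs hδA
  have hd := cdW_nonneg (P := P) (N := N) (C := C) (k := k) hL hδ₁ hCst hCM ha.le hs hδA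
  obtain ⟨hr0, hr1, -, -⟩ := seedRate_pos_le (P := P) hδ₁
  obtain ⟨hW1, hW2⟩ := W_dip_state_region hδ₁ hδ₁1 hCst hCM h210B hmixB h210AB hmixAB hmsq ha hk hkK i₀ hs hA hδA hregA hAS ht1 hb' i
  set cv₀ := cvW P N C k a δ₁ Cst CM s δA
  set cd₀ := cdW P N C k a δ₁ Cst CM s δA
  set φ := (propagatorK C Ω (A + B) msq a k - propagatorK C Ω B msq a k) (dip C B b' (onb N i))
  obtain ⟨e1, e2, e3⟩ := seqC_zero (P := P) (N := N) (C := C) (k := k) (a := a) (Cst := Cst) (s := s) (δA := δA)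
    (δ₀ := δ₁ / 2 / 2 / P.L) (cv₀ := cv₀) (cd₀ := cd₀)
  have hV0 : ∀ y, Interior k K₀ Ω y → ‖φ y‖ ≤ maj P k (cvAt P N C k a Cst s δA (δ₁ / 2 / 2 / P.L) cv₀ cd₀ 0) (2 + ((0 : ℕ) : ℝ))
      (rateAt P N C k a Cst s δA (δ₁ / 2 / 2 / P.L) cv₀ cd₀ 0) y b'.src := by
    intro y hy; rw [e1, e2, Nat.cast_zero, add_zero]; exact hW1 y hy
  have hD0 : ∀ b₀ : HiggsLattice.PBond P 0, Interior k K₀ Ω b₀.src →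
      ‖covDeriv C B φ b₀‖ ≤ maj P k (cdAt P N C k a Cst s δA (δ₁ / 2 / 2 / P.L) cv₀ cd₀ 0) (1 + ((0 : ℕ) : ℝ))
        (rateAt P N C k a Cst s δA (δ₁ / 2 / 2 / P.L) cv₀ cd₀ 0) b₀.src b'.src := by
    intro b₀ hb₀; rw [e1, e3, Nat.cast_zero, add_zero]; exact hW2 b₀ hb₀
  obtain ⟨hv1, hd1⟩ := step_state_region hδ₁ hδ₁1 hCst h210B h210AB hmsq ha hk hkK i₀ hs hA hδA hregA hAS hr0 hr1 hv hd b'.src 0 φ hV0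
    hD0 B (Or.inl rfl)
  obtain ⟨f1, -, -⟩ := seqC_succ (P := P) (N := N) (C := C) (k := k) (a := a) (Cst := Cst) (s := s) (δA := δA)
    (δ₀ := δ₁ / 2 / 2 / P.L) (cv₀ := cv₀) (cd₀ := cd₀) 0
  have hrate : rateAt P N C k a Cst s δA (δ₁ / 2 / 2 / P.L) cv₀ cd₀ (0 + 1) = dipRate P δ₁ := by
    rw [f1, e1]; rfl
  obtain ⟨-, -, hcv1, hcd1⟩ := seqC_pos (P := P) (N := N) (C := C) (k := k) (a := a) (Cst := Cst) (s := s) (δA := δA)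
    (δ₀ := δ₁ / 2 / 2 / P.L) (cv₀ := cv₀) (cd₀ := cd₀) hL hr0 hr1 hv hd hCst hs hδA (0 + 1)
  constructor
  · intro y hy
    have h := (hv1 y hy).trans (maj_exponent_reduce hcv1 y b'.src)
    rw [hrate, show (2 : ℝ) + ((0 + 1 : ℕ) : ℝ) - 1 = 2 by push_cast; ring] at h
    exact h
  · intro b₀ hb₀
    have h := (hd1 b₀ hb₀).trans (maj_exponent_reduce hcd1 b₀.src b'.src)
    rw [hrate, show (1 : ℝ) + ((0 + 1 : ℕ) : ℝ) - 1 = 1 by push_cast; ring] at h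
    exact h

/-- **The seed `Wdip^B_{b′}e_i` in the region state `0` of the WEAKENED triple `(dipRate, cvDip, cdDip)`** (rate and constants monotone).
[cite: Balaban1983Higgs3, (1.16) p.414, (2.10) p.426, p.412] -/
theorem W_dip_state_weak_region {b' : HiggsLattice.PBond P 0} (hb' : Interior k K₀ Ω b'.src) (i : Ix N) :
    (∀ y, Interior k K₀ Ω y → ‖(propagatorK C Ω (A + B) msq a k - propagatorK C Ω B msq a k) (dip C B b' (onb N i)) y‖
        ≤ maj P k (cvAt P N C k a Cst s δA (dipRate P δ₁) (cvDip P N C k a δ₁ Cst CM s δA) (cdDip P N C k a δ₁ Cst CM s δA) 0)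
            (2 + ((0 : ℕ) : ℝ))
            (rateAt P N C k a Cst s δA (dipRate P δ₁) (cvDip P N C k a δ₁ Cst CM s δA) (cdDip P N C k a δ₁ Cst CM s δA) 0)
            y b'.src) ∧
    (∀ b₀ : HiggsLattice.PBond P 0, Interior k K₀ Ω b₀.src →
      ‖covDeriv C B ((propagatorK C Ω (A + B) msq a k - propagatorK C Ω B msq a k) (dip C B b' (onb N i))) b₀‖
        ≤ maj P k (cdAt P N C k a Cst s δA (dipRate P δ₁) (cvDip P N C k a δ₁ Cst CM s δA) (cdDip P N C k a δ₁ Cst CM s δA) 0)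
            (1 + ((0 : ℕ) : ℝ))
            (rateAt P N C k a Cst s δA (dipRate P δ₁) (cvDip P N C k a δ₁ Cst CM s δA) (cdDip P N C k a δ₁ Cst CM s δA) 0)
            b₀.src b'.src) := by
  have hL : 1 < P.L := hL1
  obtain ⟨e1, e2, e3⟩ := seqC_zero (P := P) (N := N) (C := C) (k := k) (a := a) (Cst := Cst) (s := s) (δA := δA)
    (δ₀ := dipRate P δ₁) (cv₀ := cvDip P N C k a δ₁ Cst CM s δA) (cd₀ := cdDip P N C k a δ₁ Cst CM s δA)
  rw [e1, e2, e3, Nat.cast_zero, add_zero, add_zero]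
  have hv := cvW_nonneg (P := P) (N := N) (C := C) (k := k) hL hδ₁ hCst hCM ha.le hs hδA
  have hd := cdW_nonneg (P := P) (N := N) (C := C) (k := k) hL hδ₁ hCst hCM ha.le hs hδA
  obtain ⟨-, -, -, hd1⟩ := seedRate_pos_le (P := P) hδ₁
  obtain ⟨hW1, hW2⟩ := W_dip_state_region hδ₁ hδ₁1 hCst hCM h210B hmixB h210AB hmixAB hmsq ha hk hkK i₀ hs hA hδA hregA hAS ht1 hb' i
  obtain ⟨hle1, hle2, -, -⟩ := cvDip_cdDip_nonneg (P := P) (N := N) (C := C) (k := k) hL hδ₁ hCst hCM ha.le hs hδA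
  exact ⟨fun y hy => ((hW1 y hy).trans (maj_rate_mono hv hd1 y b'.src)).trans (maj_const_mono hle1 y b'.src),
    fun b₀ hb₀ => ((hW2 b₀ hb₀).trans (maj_rate_mono hd hd1 b₀.src b'.src)).trans (maj_const_mono hle2 b₀.src b'.src)⟩

/-- **BOTH INNER SEEDS `G_k(Ω,X)V_kG_k(Ω,B̃)dip^B_{b′}e_i`, `X ∈ {B̃, Ã+B̃}`, ARE IN THE REGION STATE `0` OF THE WEAKENED TRIPLE
`(dipRate, cvDip, cdDip)`** for an interior dipole bond `b′`: `X = Ã + B̃` is `W` itself ((I.3.44) from the right), `X = B̃` is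
`W − G_k(Ω,B̃)V_kW` (`GB_srcV_GB_eq_region`). [cite: Balaban1983Higgs3, (1.16) p.414, (2.10) p.426, p.412] [cite: Balaban1982Higgs1, (3.44) p.619] -/
theorem seed_state_region {b' : HiggsLattice.PBond P 0} (hb' : Interior k K₀ Ω b'.src) (i : Ix N) (X : HiggsLattice.VecField P 0)
    (hX : X = B ∨ X = A + B) :
    (∀ y, Interior k K₀ Ω y → ‖propagatorK C Ω X msq a k (srcV C A B k Ω a
          (propagatorK C Ω B msq a k (dip C B b' (onb N i)))) y‖
        ≤ maj P k (cvAt P N C k a Cst s δA (dipRate P δ₁) (cvDip P N C k a δ₁ Cst CM s δA) (cdDip P N C k a δ₁ Cst CM s δA) 0)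
            (2 + ((0 : ℕ) : ℝ))
            (rateAt P N C k a Cst s δA (dipRate P δ₁) (cvDip P N C k a δ₁ Cst CM s δA) (cdDip P N C k a δ₁ Cst CM s δA) 0)
            y b'.src) ∧
    (∀ b₀ : HiggsLattice.PBond P 0, Interior k K₀ Ω b₀.src → ‖covDeriv C B (propagatorK C Ω X msq a k (srcV C A B k Ω a
          (propagatorK C Ω B msq a k (dip C B b' (onb N i))))) b₀‖
        ≤ maj P k (cdAt P N C k a Cst s δA (dipRate P δ₁) (cvDip P N C k a δ₁ Cst CM s δA) (cdDip P N C k a δ₁ Cst CM s δA) 0)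
            (1 + ((0 : ℕ) : ℝ))
            (rateAt P N C k a Cst s δA (dipRate P δ₁) (cvDip P N C k a δ₁ Cst CM s δA) (cdDip P N C k a δ₁ Cst CM s δA) 0)
            b₀.src b'.src) := by
  have hL : 1 < P.L := hL1
  obtain ⟨e1, e2, e3⟩ := seqC_zero (P := P) (N := N) (C := C) (k := k) (a := a) (Cst := Cst) (s := s) (δA := δA)
    (δ₀ := dipRate P δ₁) (cv₀ := cvDip P N C k a δ₁ Cst CM s δA) (cd₀ := cdDip P N C k a δ₁ Cst CM s δA)
  rw [e1, e2, e3, Nat.cast_zero, add_zero, add_zero]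
  have hv := cvW_nonneg (P := P) (N := N) (C := C) (k := k) hL hδ₁ hCst hCM ha.le hs hδA
  have hd := cdW_nonneg (P := P) (N := N) (C := C) (k := k) hL hδ₁ hCst hCM ha.le hs hδA
  obtain ⟨-, -, hd0, hd1⟩ := seedRate_pos_le (P := P) hδ₁
  obtain ⟨hW1, hW2⟩ := W_dip_state_region hδ₁ hδ₁1 hCst hCM h210B hmixB h210AB hmixAB hmsq ha hk hkK i₀ hs hA hδA hregA hAS ht1 hb' i
  obtain ⟨hG1, hG2⟩ := GB_srcV_W_dip_bound_region hδ₁ hδ₁1 hCst hCM h210B hmixB h210AB hmixAB hmsq ha hk hkK i₀ hs hA hδA hregA hAS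
    ht1 hb' i
  -- `W dip` in the region state 0 of the weakened triple
  have hW1' : ∀ y, Interior k K₀ Ω y →
      ‖(propagatorK C Ω (A + B) msq a k - propagatorK C Ω B msq a k) (dip C B b' (onb N i)) y‖
        ≤ maj P k (cvW P N C k a δ₁ Cst CM s δA) 2 (dipRate P δ₁) y b'.src :=
    fun y hy => (hW1 y hy).trans (maj_rate_mono hv hd1 y b'.src)
  have hW2' : ∀ b₀ : HiggsLattice.PBond P 0, Interior k K₀ Ω b₀.src →
      ‖covDeriv C B ((propagatorK C Ω (A + B) msq a k - propagatorK C Ω B msq a k) (dip C B b' (onb N i))) b₀‖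
        ≤ maj P k (cdW P N C k a δ₁ Cst CM s δA) 1 (dipRate P δ₁) b₀.src b'.src :=
    fun b₀ hb₀ => (hW2 b₀ hb₀).trans (maj_rate_mono hd hd1 b₀.src b'.src)
  obtain ⟨hle1, hle2, -, -⟩ := cvDip_cdDip_nonneg (P := P) (N := N) (C := C) (k := k) hL hδ₁ hCst hCM ha.le hs hδA
  -- (I.3.44) read from the right on `Ω`: `G_k(Ω,A+B)V_kG_k(Ω,B) = W`
  have hGAB : ∀ ψ : ScalarField P 0 N,
      propagatorK C Ω (A + B) msq a k (srcV C A B k Ω a (propagatorK C Ω B msq a k ψ))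
        = (propagatorK C Ω (A + B) msq a k - propagatorK C Ω B msq a k) ψ := by
    intro ψ
    have hL1' : (1 : ℝ) < (P.L : ℝ) := by exact_mod_cast hL
    have hak : 0 ≤ B1.aSeq a P.L k := (B1.aSeq_pos ha hL1' hk).le
    have h := congrArg (fun T : Module.End ℝ (ScalarField P 0 N) => T ψ) (eq344_model_right C Ω A B a k hmsq hak)
    simp only [LinearMap.add_apply, Module.End.mul_apply, opV_apply_eq_srcV] at h
    rw [LinearMap.sub_apply, h]
    abel
  rcases hX with rfl | rfl
  · -- X = B: `G_BV_kG_Bdip = Wdip − G_BV_k(Wdip)`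
    constructor
    · intro y hy
      rw [GB_srcV_GB_eq_region hL hmsq ha hk, Pi.sub_apply]
      refine (norm_sub_le _ _).trans ?_
      refine (add_le_add (hW1' y hy) (hG1 y hy)).trans (le_of_eq ?_)
      rw [maj_add]; rfl
    · intro b₀ hb₀
      rw [GB_srcV_GB_eq_region hL hmsq ha hk, ← covDerivAt_apply, map_sub, covDerivAt_apply, covDerivAt_apply]
      refine (norm_sub_le _ _).trans ?_
      refine (add_le_add (hW2' b₀ hb₀) (hG2 b₀ hb₀)).trans (le_of_eq ?_)
      rw [maj_add]; rfl
  · -- X = A + B: `G_{A+B}V_kG_Bdip = Wdip`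
    constructor
    · intro y hy
      rw [hGAB]
      exact (hW1' y hy).trans (maj_const_mono hle1 y b'.src)
    · intro b₀ hb₀
      rw [hGAB]
      exact (hW2' b₀ hb₀).trans (maj_const_mono hle2 b₀.src b'.src)

/-! ## §3 The region state of `(1.16)^Ω_{n,n′}dip^B_{b′}e_i` for `n + n′ ≥ 1` -/

/-- **`(1.16)^Ω_{n,n″+1}dip^B_{b′}e_i` IS IN THE REGION STATE `n + n″` OF THE WEAKENED TRIPLE** (interior `b′`) — file R2's entry points:
`n″ + 1 ≥ 2` through `state_op116_succ_right_region` on the two inner seeds, `n″ + 1 = 1` through `state_op116_one_right_region` on the seed `W`.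
[cite: Balaban1983Higgs3, (1.16) p.414, (2.10) p.426, p.412] -/
theorem dip_state_region (n n'' : ℕ) {b' : HiggsLattice.PBond P 0} (hb' : Interior k K₀ Ω b'.src) (i : Ix N) :
    (∀ y, Interior k K₀ Ω y → ‖op116 C Ω A B msq a k n (n'' + 1) (dip C B b' (onb N i)) y‖
        ≤ maj P k (cvAt P N C k a Cst s δA (dipRate P δ₁) (cvDip P N C k a δ₁ Cst CM s δA) (cdDip P N C k a δ₁ Cst CM s δA) (n + n''))
            (2 + (((n + n'') : ℕ) : ℝ))
            (rateAt P N C k a Cst s δA (dipRate P δ₁) (cvDip P N C k a δ₁ Cst CM s δA) (cdDip P N C k a δ₁ Cst CM s δA) (n + n''))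
            y b'.src) ∧
    (∀ b₀ : HiggsLattice.PBond P 0, Interior k K₀ Ω b₀.src →
      ‖covDeriv C B (op116 C Ω A B msq a k n (n'' + 1) (dip C B b' (onb N i))) b₀‖
        ≤ maj P k (cdAt P N C k a Cst s δA (dipRate P δ₁) (cvDip P N C k a δ₁ Cst CM s δA) (cdDip P N C k a δ₁ Cst CM s δA) (n + n''))
            (1 + (((n + n'') : ℕ) : ℝ))
            (rateAt P N C k a Cst s δA (dipRate P δ₁) (cvDip P N C k a δ₁ Cst CM s δA) (cdDip P N C k a δ₁ Cst CM s δA) (n + n''))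
            b₀.src b'.src) := by
  have hL : 1 < P.L := hL1
  obtain ⟨-, -, hv, hd⟩ := cvDip_cdDip_nonneg (P := P) (N := N) (C := C) (k := k) hL hδ₁ hCst hCM ha.le hs hδA
  obtain ⟨hr0, hr1, hd0, hd1⟩ := seedRate_pos_le (P := P) hδ₁
  have hdδ : dipRate P δ₁ ≤ δ₁ := hd1.trans hr1
  cases n'' with
  | zero =>
    have hW := seed_state_region hδ₁ hδ₁1 hCst hCM h210B hmixB h210AB hmixAB hmsq ha hk hkK i₀ hs hA hδA hregA hAS ht1 hb' i (A + B)
      (Or.inr rfl)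
    have h := state_op116_one_right_region hδ₁ hδ₁1 hCst h210B h210AB hmsq ha hk hkK i₀ hs hA hδA hregA hAS hd0 hdδ hv hd b'.src n 0
      (dip C B b' (onb N i)) hW
    simp only [Nat.zero_add, Nat.add_zero] at h ⊢
    exact h
  | succ m =>
    have hVG := fun X hX =>
      seed_state_region hδ₁ hδ₁1 hCst hCM h210B hmixB h210AB hmixAB hmsq ha hk hkK i₀ hs hA hδA hregA hAS ht1 hb' i X hX
    have h := state_op116_succ_right_region hδ₁ hδ₁1 hCst h210B h210AB hmsq ha hk hkK i₀ hs hA hδA hregA hAS hd0 hdδ hv hd b'.src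
      (m + 1) n 0 (dip C B b' (onb N i)) hVG
    simp only [Nat.zero_add] at h
    exact h

/-- **`(1.16)^Ω_{m+1,0}dip^B_{b′}e_i` IS IN THE REGION STATE `m` OF THE WEAKENED TRIPLE** (interior `b′`) — file R2's left iteration
`state_op116_add_left_region` from `(1.16)^Ω_{1,0}dip = Wdip` ((I.3.44) from the left; `W_dip_state_weak_region`).
[cite: Balaban1983Higgs3, (1.16) p.414, (2.10) p.426, p.412] -/
theorem dip_state_zero_right_region (m : ℕ) {b' : HiggsLattice.PBond P 0} (hb' : Interior k K₀ Ω b'.src) (i : Ix N) :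
    (∀ y, Interior k K₀ Ω y → ‖op116 C Ω A B msq a k (m + 1) 0 (dip C B b' (onb N i)) y‖
        ≤ maj P k (cvAt P N C k a Cst s δA (dipRate P δ₁) (cvDip P N C k a δ₁ Cst CM s δA) (cdDip P N C k a δ₁ Cst CM s δA) m)
            (2 + ((m : ℕ) : ℝ))
            (rateAt P N C k a Cst s δA (dipRate P δ₁) (cvDip P N C k a δ₁ Cst CM s δA) (cdDip P N C k a δ₁ Cst CM s δA) m)
            y b'.src) ∧
    (∀ b₀ : HiggsLattice.PBond P 0, Interior k K₀ Ω b₀.src →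
      ‖covDeriv C B (op116 C Ω A B msq a k (m + 1) 0 (dip C B b' (onb N i))) b₀‖
        ≤ maj P k (cdAt P N C k a Cst s δA (dipRate P δ₁) (cvDip P N C k a δ₁ Cst CM s δA) (cdDip P N C k a δ₁ Cst CM s δA) m)
            (1 + ((m : ℕ) : ℝ))
            (rateAt P N C k a Cst s δA (dipRate P δ₁) (cvDip P N C k a δ₁ Cst CM s δA) (cdDip P N C k a δ₁ Cst CM s δA) m)
            b₀.src b'.src) := by
  have hL : 1 < P.L := hL1
  obtain ⟨-, -, hv, hd⟩ := cvDip_cdDip_nonneg (P := P) (N := N) (C := C) (k := k) hL hδ₁ hCst hCM ha.le hs hδA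
  obtain ⟨hr0, hr1, hd0, hd1⟩ := seedRate_pos_le (P := P) hδ₁
  have hdδ : dipRate P δ₁ ≤ δ₁ := hd1.trans hr1
  have hW := W_dip_state_weak_region hδ₁ hδ₁1 hCst hCM h210B hmixB h210AB hmixAB hmsq ha hk hkK i₀ hs hA hδA hregA hAS ht1 hb' i
  -- `(1.16)^Ω_{1,0} = W` (file R2's `W_apply_eq_op116_one_zero_region`)
  have h10 : ∀ ψ : ScalarField P 0 N, (propagatorK C Ω (A + B) msq a k - propagatorK C Ω B msq a k) ψ
      = op116 C Ω A B msq a k 1 0 ψ :=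
    fun ψ => B3Op116DKernelRegularRegion.W_apply_eq_op116_one_zero_region hL hmsq ha hk ψ
  simp only [h10] at hW
  have h := state_op116_add_left_region hδ₁ hδ₁1 hCst h210B h210AB hmsq ha hk hkK i₀ hs hA hδA hregA hAS hd0 hdδ hv hd b'.src 1 0 m 0
    (dip C B b' (onb N i)) hW
  simp only [Nat.zero_add] at h
  rw [Nat.add_comm m 1]
  exact h

/-! ## §4 The theorem: the mixed entry of the kernel of (1.16) on a region, uniformly bounded and decaying at interior points for `n + n′ > d` -/

/-- **THE MIXED (DIPOLE–DIPOLE) ENTRY OF THE KERNEL OF (1.16) ON A REGION IS UNIFORMLY BOUNDED AND EXPONENTIALLY DECAYING AT INTERIOR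
POINTS, FOR ALL `n + n′ > d`** (the member of print's *"Hölder norms of the covariant derivatives of this kernel"* with one covariant
derivative in each variable, p. 414, at print's general region `Ω ⊆ T_ε`): for `m² > 0`, `a > 0`, `1 ≤ k ≤ K`, the (2.10) bounds
`Ineq210 δ₁ C` of `G_k(Ω,B̃)`, `G_k(Ω,Ã+B̃)` at interior pairs and their twice-differentiated per-piece form with `C_M`, `0 < δ₁ ≤ 1`,
`sup_b|Ã_b| ≤ s`, `Ã` (I.2.23)-regular with `δ_A` and supported on deep bonds (p. 412), `(L^kε)|e|s ≤ 1`, every direction pair `μ, ν` and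
every INTERIOR `x, x′`:
`ε^{−d}·(ε^{−1}·Σ_i‖(D^ε_B(1.16)^Ω_{n,n′}dip^B_{⟨x′,ν⟩}e_i)(⟨x,μ⟩)‖) ≤ mixC(n+n′)·(L^kε)^{n+n′}·((L^kε)^d)^{−1}·exp(−δ^mix_{n+n′−1}·|x−x′|/L^k)` —
the binder `hM` of `B3Ineq25Op116Smooth.ineq25At_op116_smooth_of_bounds` with the torus constant `mixC` and rate `δ^mix_J = δ₁/(4L)^{J+2}`
(`mixRate_eq`). [cite: Balaban1983Higgs3, (1.16) p.414, (2.5) p.424, (2.10) p.426, p.412] [cite: Balaban1982Higgs1, Prop. 2.1 (2.25) p.610, (3.44) p.619] [cite: Balaban1983RegularityDecay, Theorem p.573] -/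
theorem kernel116_mixed_le_region (n n' : ℕ) (hd : P.d < n + n') (μ ν : Fin P.d) {x x' : HiggsLattice.Site P 0}
    (hx : Interior k K₀ Ω x) (hx' : Interior k K₀ Ω x') :
    (P.mesh 0 ^ P.d)⁻¹ * ((P.mesh 0)⁻¹ *
        ∑ i : Ix N, ‖covDeriv C B (op116 C Ω A B msq a k n n' (dip C B ⟨x', ν⟩ (onb N i))) ⟨x, μ⟩‖)
      ≤ mixC P N C k a δ₁ Cst CM s δA (n + n') * P.mesh k ^ (n + n') * (P.mesh k ^ P.d)⁻¹ *
          Real.exp (-(rateAt P N C k a Cst s δA (dipRate P δ₁) (cvDip P N C k a δ₁ Cst CM s δA) (cdDip P N C k a δ₁ Cst CM s δA)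
            (n + n' - 1) * ((HiggsLattice.Site.tdist x x' : ℝ) / (P.L : ℝ) ^ k))) := by
  have hL : 1 < P.L := hL1
  set J := n + n' - 1 with hJdef
  set M := n + n' with hMdef
  have hMJ : M = J + 1 := by omega
  have hM1 : M - 1 = J := by omega
  set cv₁ := cvDip P N C k a δ₁ Cst CM s δA
  set cd₁ := cdDip P N C k a δ₁ Cst CM s δA
  obtain ⟨-, -, hv, hdd⟩ := cvDip_cdDip_nonneg (P := P) (N := N) (C := C) (k := k) hL hδ₁ hCst hCM ha.le hs hδA
  obtain ⟨hr0, hr1, hd0, hd1⟩ := seedRate_pos_le (P := P) hδ₁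
  obtain ⟨hrJ, -, -, hcdJ⟩ := seqC_pos (P := P) (N := N) (C := C) (k := k) (a := a) (Cst := Cst) (s := s) (δA := δA)
    (δ₀ := dipRate P δ₁) (cv₀ := cv₁) (cd₀ := cd₁) hL hd0 (hd1.trans hr1) hv hdd hCst hs hδA J
  have hdM : (P.d : ℝ) < (M : ℝ) := by exact_mod_cast hd
  have hsM : 0 < (M : ℝ) - (P.d : ℝ) := by linarith
  have hε : 0 ≤ (P.mesh 0 ^ P.d)⁻¹ := inv_nonneg.mpr (pow_nonneg (P.mesh_pos 0).le _)
  have hε' : 0 ≤ (P.mesh 0)⁻¹ := inv_nonneg.mpr (P.mesh_pos 0).le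
  have hsrc : (⟨x, μ⟩ : HiggsLattice.PBond P 0).src = x := rfl
  have hsrc' : (⟨x', ν⟩ : HiggsLattice.PBond P 0).src = x' := rfl
  have hbx : Interior k K₀ Ω (⟨x, μ⟩ : HiggsLattice.PBond P 0).src := hx
  have hbx' : Interior k K₀ Ω (⟨x', ν⟩ : HiggsLattice.PBond P 0).src := hx'
  have hexp : (1 : ℝ) + ((J : ℕ) : ℝ) - (P.d : ℝ) = (M : ℝ) - (P.d : ℝ) := by rw [hMJ]; push_cast; ring
  -- each `i`: the region state `J` of `(1.16)^Ω_{n,n′}dip^B_{⟨x′,ν⟩}e_i`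
  have hstate : ∀ i : Ix N, ‖covDeriv C B (op116 C Ω A B msq a k n n' (dip C B ⟨x', ν⟩ (onb N i))) ⟨x, μ⟩‖
      ≤ maj P k (cdAt P N C k a Cst s δA (dipRate P δ₁) cv₁ cd₁ J) (1 + ((J : ℕ) : ℝ))
          (rateAt P N C k a Cst s δA (dipRate P δ₁) cv₁ cd₁ J) x x' := by
    intro i
    cases n' with
    | zero =>
      obtain ⟨m, rfl⟩ : ∃ m, n = m + 1 := ⟨n - 1, by omega⟩
      have hJm : J = m := by omega
      have h := (dip_state_zero_right_region hδ₁ hδ₁1 hCst hCM h210B hmixB h210AB hmixAB hmsq ha hk hkK i₀ hs hA hδA hregA hAS ht1 m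
        hbx' i).2 ⟨x, μ⟩ hbx
      rw [hsrc, hsrc'] at h
      rw [hJm]
      exact h
    | succ n'' =>
      have hJm : J = n + n'' := by omega
      have h := (dip_state_region hδ₁ hδ₁1 hCst hCM h210B hmixB h210AB hmixAB hmsq ha hk hkK i₀ hs hA hδA hregA hAS ht1 n n'' hbx' i).2
        ⟨x, μ⟩ hbx
      rw [hsrc, hsrc'] at h
      rw [hJm]
      exact h
  -- the top-scale domination (p33's `majorant_le_top`, threshold `M − d > 0`)
  have hpt : ∀ i : Ix N, ‖covDeriv C B (op116 C Ω A B msq a k n n' (dip C B ⟨x', ν⟩ (onb N i))) ⟨x, μ⟩‖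
      ≤ cdAt P N C k a Cst s δA (dipRate P δ₁) cv₁ cd₁ J / ((P.L : ℝ) ^ ((M : ℝ) - (P.d : ℝ)) - 1) * P.mesh k ^ ((M : ℝ) - (P.d : ℝ)) *
          Real.exp (-(rateAt P N C k a Cst s δA (dipRate P δ₁) cv₁ cd₁ J * (P.mesh k)⁻¹ *
            (P.mesh 0 * (HiggsLattice.Site.tdist x x' : ℝ)))) := by
    intro i
    refine (hstate i).trans ?_
    unfold maj
    rw [hexp]
    exact majorant_le_top hL hcdJ hsM hrJ.le x x'
  have hsplit : P.mesh k ^ ((M : ℝ) - (P.d : ℝ)) = P.mesh k ^ M * (P.mesh k ^ P.d)⁻¹ := by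
    have h := mesh_rpow_split (P := P) (k := k) 0 M
    simp only [Nat.cast_zero, zero_add, pow_zero, one_mul] at h
    exact h
  calc (P.mesh 0 ^ P.d)⁻¹ * ((P.mesh 0)⁻¹ *
        ∑ i : Ix N, ‖covDeriv C B (op116 C Ω A B msq a k n n' (dip C B ⟨x', ν⟩ (onb N i))) ⟨x, μ⟩‖)
      ≤ (P.mesh 0 ^ P.d)⁻¹ * ((P.mesh 0)⁻¹ * ∑ _i : Ix N,
          cdAt P N C k a Cst s δA (dipRate P δ₁) cv₁ cd₁ J / ((P.L : ℝ) ^ ((M : ℝ) - (P.d : ℝ)) - 1) * P.mesh k ^ ((M : ℝ) - (P.d : ℝ)) *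
            Real.exp (-(rateAt P N C k a Cst s δA (dipRate P δ₁) cv₁ cd₁ J * (P.mesh k)⁻¹ *
              (P.mesh 0 * (HiggsLattice.Site.tdist x x' : ℝ))))) :=
        mul_le_mul_of_nonneg_left (mul_le_mul_of_nonneg_left (Finset.sum_le_sum fun i _ => hpt i) hε') hε
    _ = _ := by
        rw [Finset.sum_const, Finset.card_univ, nsmul_eq_mul, hsplit, rate_div_eq, mixC, hM1]
        ring

end Seeds

end Literature.MathematicalPhysics.QuantumFieldTheory.Balaban1983to89.B3Op116MixedKernelRegularRegion

end
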